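import Summits.BirchSwinnertonDyer.BirchSwinnertonDyer.Theorems.AdditiveBranchIMCTameLocalVanishingCore
import Summits.BirchSwinnertonDyer.BirchSwinnertonDyer.Theorems.AdditiveBranchIMCGordTwoRankZeroOffCaseOneFieldSupplyR0
import HarnessLib

/-!
# Registered stub `stub_tameLocalVanishingR0` of line `three_field_road` (v19/v20) — PROVED, BY NAME AND SIGNATURE: the TAME LOCAL
# VANISHING `E_K[p^∞]^{Gal(K̄/K̃_∞) ∩ I_{𝔭′}} = 0` on the cell (G-ord, `e = 2`) with `p ≥ 5` (crux `AdditiveBranchIMC.GordTwoRankZeroOffCaseOne`,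
# stmt-BirchSwinnertonDyer-19357); the line vocabulary `TameLocalVanishingAt` lives HERE for the sibling by-name files of
# `wan_tame_bdp_road` (19358, `stub_localVanishing`) and `tame_roads_mult` (19359, `stub_tameLocalVanishingM`)

Stub-worker seat `bsd-addord-k1tame-w2` (gen 0) under LEAD `cruxlead-19357` (LeadReport13 §3/§5). One `def … : Prop`
(`TameLocalVanishingAt`, the LINE VOCABULARY of the skeleton `Cruxes/GordTwoRankZeroOffCaseOne/Lines/three_field_road.lean` v20
repeated VERBATIM so that the stub can be stated by name and signature under the Theorems import fence; `WanPrime`, `TameRoadRow`,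
`TameRoadField` are the verbatim copies already landed in `…FieldSupplyR0` (`ThreeFieldRoadSupply`); all definitionally equal to the
skeleton's — and byte-identical in `Cruxes/MultLower/Lines/tame_roads_mult.lean` and `Cruxes/GordTwoRankOne/Lines/wan_tame_bdp_road.lean`
v20 —, nothing asserted by them) and ONE theorem, a two-line application of the sibling file's
`TameLocalVanishing.tameLocalVanishing_cellGordTwo` (`…TameLocalVanishingCore`: good-ordinary partner + Serre's ordinary line + the
`ℤ_p²`-tower's inertia at a split `p` surjecting onto `𝔽_pˣ` + the tame miracle on `V[p] ⊗ χ_{p*}` + base change). No named fact, no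
`sorry`; BSD is proved for no curve; the crux item stays OPEN. From `TameRoadRow` only `5 ≤ p` is used, from `TameRoadField` only
`[K : ℚ] = 2` and `SatisfiesHeegnerHypothesis p K`; the anticyclotomic / generator-pair binders are not used.

References: [Serre1972] §1.11; [SerreLocalFields1979] IV §4 Prop. 17; [SilvermanAEC2009] X.5 Cor. 5.4; LeadReport13 §3, §5.
-/

set_option linter.dupNamespace false

noncomputable section

open scoped Classical NumberField
open Field NumberField IsDedekindDomain WeierstrassCurve
open Literature.NumberTheory.GaloisRepresentations Literature.NumberTheory.EllipticCurves
  Literature.NumberTheory.EllipticCurves.ZpExtension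
  Literature.NumberTheory.EllipticCurves.Rank1Residual
  Summit.BirchSwinnertonDyer.Rank1Residual Summit.BirchSwinnertonDyer.Rank1Residual.Additive
  Summit.BirchSwinnertonDyer.BirchSwinnertonDyer.Theorems.ThreeFieldRoadSupply

namespace Summit.BirchSwinnertonDyer.BirchSwinnertonDyer.Theorems.TameLocalVanishing

/-- TAME LOCAL VANISHING at `(E, p, K)` — VERBATIM the skeleton's `TameLocalVanishingAt` (v19/v20; existing vocabulary only —
`ZpExtension.pairKer`, `GreenbergSelmer.inertia`, `WeierstrassCurve.geomPrimaryTorsion`): for every anticyclotomic `(κ, γ)`, every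
`𝔭′ ∣ p` and EVERY completion `(κ₁, γ₁)` of `(κ, γ)` to a topological generator pair of the `ℤ_p²`-tower `K̃_∞`, `E_K[p^∞]` has NO
non-zero point fixed by the inertia group `Gal(K̄/K̃_∞) ∩ I_{𝔭′}` of `K̃_∞` at `𝔭′`. Line vocabulary repeated so that the
registered stub can be stated by name and signature under the Theorems import fence; NOTHING IS ASSERTED.
[predicate; nothing asserted] [cite: Serre1972, §1.11–1.12 (inertia action on `E[p]`: ordinary and Tate-curve cases)]
[cite: SkinnerUrban2014, Prop. 3.2.8 (p. 23)] [cite: Washington1997, Thm. 13.4 (ℤ_p-rank of an imaginary quadratic field)] -/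
def TameLocalVanishingAt (W : WeierstrassCurve ℚ) [W.IsElliptic] [W.IsGloballyMinimal] (p : ℕ) [Fact p.Prime]
    (K : Type) [Field K] [NumberField K] : Prop :=
  ∀ (κ : ZpExtension K p), κ.IsAnticyclotomic → ∀ (γ : Field.absoluteGaloisGroup K) [Fact (κ.IsTopGenerator γ)]
    (𝔭' : HeightOneSpectrum (𝓞 K)), ((p : ℕ) : 𝓞 K) ∈ 𝔭'.asIdeal →
    ∀ (κ₁ : ZpExtension K p) (γ₁ : Field.absoluteGaloisGroup K) [Fact (ZpExtension.IsTopGeneratorPair κ₁ κ γ₁ γ)],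
      ∀ m : (W.baseChange K).geomPrimaryTorsion p,
        (∀ x : Field.absoluteGaloisGroup K, x ∈ ZpExtension.pairKer κ₁ κ → x ∈ GreenbergSelmer.inertia 𝔭' → x • m = m) →
          m = 0

/-- **Registered stub `stub_tameLocalVanishingR0` of line `three_field_road` (crux 19357), BY NAME AND SIGNATURE: the tame local
vanishing on the (G-ord, `e = 2`) cell along the tame sub-row at a tame-road field.** From `N10.CellGordTwo` the good-ordinary
partner `V` with `C • V^{(p*)} = W`, Serre's ordinary line of `V[p]` at every `𝔏 ∣ p`, the `ℤ_p²`-tower's inertia at the split `p`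
surjecting onto `𝔽_pˣ`, the tame miracle on `V[p] ⊗ χ_{p*}`, base change — all in `tameLocalVanishing_cellGordTwo`
(`…TameLocalVanishingCore`); from `TameRoadRow` only `5 ≤ p`, from `TameRoadField` only `[K : ℚ] = 2` and `p` split
(`SatisfiesHeegnerHypothesis p K`). The anticyclotomic and
generator-pair binders are not used (the vanishing holds for ANY pair of `ℤ_p`-extensions).
[cite: Serre1972, §1.11 Prop. 11 and Cor.] [cite: SerreLocalFields1979, Ch. IV §4 Prop. 17] [cite: SilvermanAEC2009, X.5 Cor. 5.4] -/
theorem stub_tameLocalVanishingR0 :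
    ∀ (W : WeierstrassCurve ℚ) [W.IsElliptic] [W.IsGloballyMinimal] (p : ℕ) [Fact p.Prime]
      (K : Type) [Field K] [NumberField K],
      N10.CellGordTwo W p → TameRoadRow W p → TameRoadField W p K → TameLocalVanishingAt W p K := by
  intro W _ _ p hp K _ _ hcell hrow hK κ _ γ _ 𝔭' h𝔭' κ₁ γ₁ _ m hm
  exact tameLocalVanishing_cellGordTwo W p K hcell hrow.1 hK.1.1 (hK.2.2.2 p hp.out (dvd_refl p)) κ₁ κ 𝔭' h𝔭' m hm

end Summit.BirchSwinnertonDyer.BirchSwinnertonDyer.Theorems.TameLocalVanishing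

end
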